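import Literature.NumberTheory.GaloisRepresentations.IdeleClassBarModPairingArtin
import Literature.NumberTheory.GaloisRepresentations.IdeleClassAlphaOneLayers
import Literature.NumberTheory.GaloisRepresentations.GalLayerEmbedding
import Literature.Algebra.Homology.DiscreteRepInvariants
import HarnessLib

/-!
# Milne's (b) for `(U_L, Res C̄)`, injectivity: an invariant vector `φ : ℤ → Res_U C̄` pairing to zero with every
# trace-layer character is divisible by `m` (Tate C–F VII §11.3 + §5.1 (B)/(D); Milne ADT I Thm. 1.8 (b))

Topic `NumberTheory/GaloisRepresentations`; namespace `Literature.NumberTheory.GaloisRepresentations.IdeleClassBar`.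
Sequel to door-c4 g16's `IdeleClassBarModPairingArtin.lean` (the layer pairing values of `(U_L, Res C̄)` are door-c6's
`classInvAll L E (baseCup x (β_m [χ ∘ g]))`) and door-c6 g14's `IdeleClassAlphaOneLayers.lean`
(`forall_layer_pairing_eq_zero_iff_mem_range_pow`: over the base `L`, `inv_{K/L}(ι[x] ∪ β_m[χ]) = 0` for all finite
abelian `K ⊆ L̄` and all `χ` iff `x̄ ∈ C_Lᵐ`), `IdeleClassCharacterPairing.lean` (`classInvAll_baseCup_bockstein_comp`:
inflation invariance).  Theorems only (no definition, no named fact, no instance, no notation, no `sorry`).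

THE POINT (`exists_nsmul_eq_of_forall_layer_value_eq_zero`).  Let `U = U_L`, `φ : ℤ → Res_U C̄` (an element
`c₀ ∈ C̄^U = C_L`, door-c5 `mem_invariants_iff`) with `inv_U (Inf (H²(id, φ_V) (β_m χ))) = 0` for every layer `E ⊇ L` and
every `χ ∈ H¹(U_L ⧸ (U_E ∩ U_L), ℤ/m)`.  Choose an idèle `x₀` of `L` with class `c₀`.  For a finite abelian `K/L` inside an
algebraic closure of `L` and `χ_K : Gal(K/L) → ℤ/m`: `K` embeds over `L` into some layer `M ⊇ L` of `F̄`
(`GalLayer.exists_ge_nonempty_algHom`, `IsAlgClosed.lift` + normal closure), door-c6's inflation invariance moves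
`inv_{K/L}(ι[x₀] ∪ β_m[χ_K])` to the layer `M`, where it is a layer pairing value of `φ` (`…Artin`, with `x_M = ι[x₀]` by
`coe_baseInvariant_eq_layerVector_of_ne`; the degenerate `M = L` has trivial Galois group), hence `0`.  So `x̄₀ ∈ C_Lᵐ`
(door-c6), `c₀ = m • c`, and `φ = m • φ₂` for the invariant vector `φ₂` of `c` (door-c4 `homTrivEquiv`).

HONEST FRAMING: bookkeeping over door-c6 g14's class field theory; no case of BSD or of Poitou–Tate is proved.  Route A
(A5)-ARITH of crux `AnticycControlAdditiveK` (item 19295, cell bsd-schneider), seat door-c4 gen 16: this is the hypothesis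
`Hinj` of door-c4 g16's `adjointInjective_triv_zmod_of_cofinal` for `(U_L, Res C̄)` and the trace layers.

## References
* J. S. Milne, *Arithmetic Duality Theorems* (2nd ed. 2006), I §1 Theorem 1.8 (b). [MilneADT2006]
* J. W. S. Cassels, A. Fröhlich (eds.), *Algebraic Number Theory* (1967), Ch. VII (J. Tate) §5.1 (B), (D), §11.1, §11.3.
  [CasselsFrohlichANT1967]
* J. Neukirch, *Class Field Theory — The Bonn Lectures* (2013), Part III Thm. (7.12). [Neukirch2013]
-/

noncomputable section

-- as in door-c6's `IdeleClassCharacterPairing*` / `IdeleClassAlphaOneLayers`: Bockstein classes across the definitionally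
-- equal objects `(intModShortComplex G m).Xᵢ = Rep.trivial ℤ G _`
set_option backward.isDefEq.respectTransparency false

open NumberField CategoryTheory groupCohomology
open Field (absoluteGaloisGroup)
open Literature.NumberTheory.Automorphic Literature.NumberTheory.Automorphic.IdeleClassGroup
open Literature.NumberTheory.NumberFields
open Literature.Algebra.Homology Literature.Algebra.Homology.DiscreteRep
open scoped Classical

namespace Literature.NumberTheory.GaloisRepresentations

namespace IdeleClassBar

variable {F : Type} [Field F] [NumberField F]

/-! ## §29. Every finite extension of `L` embeds over `L` into a layer `M ⊇ L` of `F̄` -/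

/-- **Every finite extension `K` of the layer `L` embeds `L`-linearly into some layer `M ⊇ L` of `F̄`**: embed `K` into
`F̄` over `L` (`IsAlgClosed.lift`) and take the normal closure over `F` of `K` inside `F̄` (finite and Galois over `F`,
characteristic `0`). [cite: CasselsFrohlichANT1967, Ch. VII §11.1] -/
theorem GalLayer.exists_ge_nonempty_algHom (L : GalLayer F) (K : Type) [Field K] [Algebra L.1 K]
    [FiniteDimensional L.1 K] :
    ∃ (M : GalLayer F) (h : L ≤ M), Nonempty (letI := GalLayer.algebraOfLE h; K →ₐ[L.1] M.1) := by
  haveI := L.finiteDimensional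
  letI : Algebra F K := ((algebraMap L.1 K).comp (algebraMap F L.1)).toAlgebra
  haveI : IsScalarTower F L.1 K := IsScalarTower.of_algebraMap_eq fun _ => rfl
  haveI : FiniteDimensional F K := Module.Finite.trans L.1 K
  haveI : Algebra.IsAlgebraic L.1 K := Algebra.IsAlgebraic.of_finite L.1 K
  -- embed `K` into `F̄` over `L`
  let φ : K →ₐ[L.1] AlgebraicClosure F := IsAlgClosed.lift
  let M₀ : IntermediateField F (AlgebraicClosure F) := IntermediateField.normalClosure F K (AlgebraicClosure F)
  haveI : FiniteDimensional F M₀ := normalClosure.is_finiteDimensional F K (AlgebraicClosure F)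
  haveI : Algebra.IsSeparable F M₀ :=
    Algebra.IsAlgebraic.isSeparable_of_perfectField (K := F) (L := M₀)
  haveI : IsGalois F M₀ := isGalois_iff.2 ⟨inferInstance, inferInstance⟩
  have hφM : ∀ k : K, φ k ∈ M₀ := fun k =>
    AlgHom.fieldRange_le_normalClosure (φ.restrictScalars F) ((AlgHom.mem_fieldRange (f := φ.restrictScalars F)).2 ⟨k, rfl⟩)
  let M : GalLayer F := ⟨M₀, inferInstance, inferInstance⟩
  have hle : L ≤ M := fun x hx => by
    have h1 := hφM (algebraMap L.1 K ⟨x, hx⟩)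
    rw [AlgHom.commutes] at h1
    exact h1
  refine ⟨M, hle, ⟨?_⟩⟩
  letI := GalLayer.algebraOfLE hle
  exact
    { toFun := fun k => ⟨φ k, hφM k⟩
      map_one' := Subtype.ext (map_one φ)
      map_mul' := fun a b => Subtype.ext (map_mul φ a b)
      map_zero' := Subtype.ext (map_zero φ)
      map_add' := fun a b => Subtype.ext (map_add φ a b)
      commutes' := fun r => Subtype.ext (φ.commutes r) }

omit [NumberField F] in
/-- The Galois group of a layer over ITSELF (`L ≤ M` with `L = M`, algebra structure `algebraOfLE`) is trivial.
[cite: CasselsFrohlichANT1967, Ch. VII §11.1] -/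
theorem GalLayer.subsingleton_algEquiv_of_eq {L M : GalLayer F} (h : L ≤ M) (hLM : L = M) :
    letI := GalLayer.algebraOfLE h; Subsingleton (M.1 ≃ₐ[L.1] M.1) := by
  subst hLM
  letI := GalLayer.algebraOfLE h
  refine ⟨fun σ τ => AlgEquiv.ext fun y => ?_⟩
  have hy : y = algebraMap L.1 L.1 y := Subtype.ext rfl
  rw [hy, AlgEquiv.commutes, AlgEquiv.commutes]

/-! ## §30. `x_E = ι[x₀]` for ONE idèle `x₀` of `L`, at every layer `E ≠ L` -/

variable {L E : GalLayer F}

/-- **`x_E = ι[x₀]` uniformly**: if the class of the idèle `x₀` of `L` is the element `φ(1) ∈ C̄^{U_L} = C_L`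
(`[x̄₀] = φ(1)` in `C̄`), then at every layer `E ⊋ L` the vector `x_E = layerVector h φ` is `ι[x₀]` (door-c5
`ofLayer_baseChangeHom`, door-c6 `coe_baseInvariant`). [cite: CasselsFrohlichANT1967, Ch. VII §8 Prop. 8.1] -/
theorem coe_baseInvariant_eq_layerVector_of_ne (h : L ≤ E) (hne : L ≠ E)
    (φ : triv (k := ℤ) (Γ := (L.openNormalSubgroup : Subgroup (absoluteGaloisGroup F))) ℤ ⟶
      (resD ℤ (L.openNormalSubgroup : Subgroup (absoluteGaloisGroup F))).obj (classData F).toSystem.toD)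
    (x₀ : haveI := L.numberField; ideleGroup L.1)
    (hx₀ : haveI := L.numberField;
      ofLayer F L (Additive.ofMul (x₀ : IdeleClassGroup L.1)) = φ.hom.hom (1 : ℤ)) :
    letI := GalLayer.algebraOfLE h; haveI := GalLayer.isScalarTower_of_le h; haveI := L.numberField;
    haveI := E.numberField; haveI := E.isGalois; haveI : IsGalois L.1 E.1 := IsGalois.tower_top_of_isGalois F L.1 E.1;
    ((IdeleCohomology.baseInvariant (E := E.1) x₀ : (IdeleClassGroup.galoisRep L.1 E.1).ρ.invariants) :
        (IdeleClassGroup.galoisRep L.1 E.1).V) = layerVector h φ := by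
  letI := GalLayer.algebraOfLE h
  haveI := GalLayer.isScalarTower_of_le h
  haveI := L.numberField
  haveI := E.numberField
  haveI := E.isGalois
  haveI : IsGalois L.1 E.1 := IsGalois.tower_top_of_isGalois F L.1 E.1
  symm
  refine ((classData F).relLayerEquiv_eq_iff (GalLayer.coe_openNormalSubgroup_le h) _ _).2 ?_
  rw [IdeleCohomology.coe_baseInvariant, classData_of]
  change φ.hom.hom (1 : ℤ) = ofLayer F E (baseChangeHom h (Additive.ofMul (x₀ : IdeleClassGroup L.1)))
  rw [ofLayer_baseChangeHom h hne, hx₀]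

/-! ## §31. Injectivity: `φ ⊥` all trace-layer characters `⟹ φ = m • φ₂` -/

/-- `φ(1) ∈ C̄^{U_L}` for a morphism `φ : ℤ → Res_{U_L} C̄`. [cite: Harari2020, §4.3] -/
theorem hom_apply_one_mem_invariants (L : GalLayer F)
    (φ : triv (k := ℤ) (Γ := (L.openNormalSubgroup : Subgroup (absoluteGaloisGroup F))) ℤ ⟶
      (resD ℤ (L.openNormalSubgroup : Subgroup (absoluteGaloisGroup F))).obj (classData F).toSystem.toD) :
    φ.hom.hom (1 : ℤ) ∈ Representation.invariants
      ((classData F).toSystem.toRep.ρ.comp (L.openNormalSubgroup : Subgroup (absoluteGaloisGroup F)).subtype) :=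
  fun u => (Rep.hom_comm_apply φ.hom u (1 : ℤ)).symm

set_option synthInstance.maxHeartbeats 100000 in
set_option maxHeartbeats 800000 in
-- instance synthesis over `K ⊆ L̄` (an intermediate field of the algebraic closure of a layer) is slow
/-- **Every `inv_{K/L}(ι[x₀] ∪ β_m[χ_K])` (`K/L` finite abelian) vanishes when the trace-layer values of `φ` do**, for
the idèle `x₀` of `L` representing `φ(1) ∈ C̄^{U_L} = C_L`: embed `K` over `L` into a layer `M ⊇ L`
(`GalLayer.exists_ge_nonempty_algHom`), move the value to `M` by door-c6's inflation invariance
(`classInvAll_baseCup_bockstein_comp`), and read it there as a layer pairing value of `φ`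
(`layerPairingValue_eq_classInvAll_baseCup`, `x_M = ι[x₀]`); the degenerate layer `M = L` has trivial Galois group.
[cite: CasselsFrohlichANT1967, Ch. VII §11.2 (bis), §11.3][cite: MilneADT2006, I Theorem 1.8 (b)] -/
theorem classInvAll_baseCup_eq_zero_of_forall_layer_value_eq_zero (L : GalLayer F) {m : ℕ} (hm : 0 < m)
    (φ : triv (k := ℤ) (Γ := (L.openNormalSubgroup : Subgroup (absoluteGaloisGroup F))) ℤ ⟶
      (resD ℤ (L.openNormalSubgroup : Subgroup (absoluteGaloisGroup F))).obj (classData F).toSystem.toD)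
    (H : ∀ (E : GalLayer F) (_ : L ≤ E)
      (χ : groupCohomology (Rep.trivial ℤ ((L.openNormalSubgroup : Subgroup (absoluteGaloisGroup F)) ⧸
        (traceOpenNormalSubgroup (L.openNormalSubgroup : Subgroup (absoluteGaloisGroup F)) E.openNormalSubgroup :
          Subgroup (L.openNormalSubgroup : Subgroup (absoluteGaloisGroup F)))) (ZMod m)) 1),
      haveI : NeZero m := ⟨hm.ne'⟩
      classBarInvAt F (L.openNormalSubgroup : Subgroup (absoluteGaloisGroup F)) (LayerColimit.coe_isOpen _)
        (LayerColimit.inflG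
          (traceOpenNormalSubgroup (L.openNormalSubgroup : Subgroup (absoluteGaloisGroup F)) E.openNormalSubgroup)
          ((resD ℤ (L.openNormalSubgroup : Subgroup (absoluteGaloisGroup F))).obj (classData F).toSystem.toD) 2
          (groupCohomology.map (MonoidHom.id _)
            (LayerColimit.homToLayer
              (traceOpenNormalSubgroup (L.openNormalSubgroup : Subgroup (absoluteGaloisGroup F)) E.openNormalSubgroup :
                Subgroup (L.openNormalSubgroup : Subgroup (absoluteGaloisGroup F)))
              ((resD ℤ (L.openNormalSubgroup : Subgroup (absoluteGaloisGroup F))).obj (classData F).toSystem.toD) φ) 2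
            (groupCohomology.δ (Bockstein.intModShortComplex_shortExact
              ((L.openNormalSubgroup : Subgroup (absoluteGaloisGroup F)) ⧸
                (traceOpenNormalSubgroup (L.openNormalSubgroup : Subgroup (absoluteGaloisGroup F)) E.openNormalSubgroup :
                  Subgroup (L.openNormalSubgroup : Subgroup (absoluteGaloisGroup F)))) m) 1 2 rfl χ))) = 0)
    (x₀ : haveI := L.numberField; ideleGroup L.1)
    (hx₀ : haveI := L.numberField;
      ofLayer F L (Additive.ofMul (x₀ : IdeleClassGroup L.1)) = φ.hom.hom (1 : ℤ))
    (K : haveI := L.numberField; IntermediateField L.1 (AlgebraicClosure L.1))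
    (hK : haveI := L.numberField; FiniteDimensional L.1 K) (hab : haveI := L.numberField; IsAbelianGalois L.1 K)
    (χK : haveI := L.numberField; Additive (K ≃ₐ[L.1] K) →+ ZMod m) :
    haveI := L.numberField; haveI : NumberField K := NumberField.of_module_finite L.1 K; haveI : NeZero m := ⟨hm.ne'⟩
    IdeleCohomology.classInvAll L.1 K (IdeleCohomology.baseCup (E := K) x₀
      (groupCohomology.δ (Bockstein.intModShortComplex_shortExact (K ≃ₐ[L.1] K) m) 1 2 rfl
        ((H1IsoOfIsTrivial (Rep.trivial ℤ (K ≃ₐ[L.1] K) (ZMod m))).inv χK))) = 0 := by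
  haveI : NeZero m := ⟨hm.ne'⟩
  haveI := L.numberField
  haveI := hK
  -- a layer `M ⊇ L` of `F̄` containing `K` over `L` (`Exists.elim`, not `obtain`: casing the existential against this
  -- goal is prohibitively slow)
  have hex := GalLayer.exists_ge_nonempty_algHom L K
  refine hex.elim fun M hM => hM.elim fun hLM hψ => hψ.elim fun ψ => ?_
  clear hM hψ hex
  letI := GalLayer.algebraOfLE hLM
  haveI := GalLayer.isScalarTower_of_le hLM
  haveI := M.numberField
  haveI := M.isGalois
  haveI : IsGalois L.1 M.1 := IsGalois.tower_top_of_isGalois F L.1 M.1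
  -- the layer facts about `M` (before the instances of `K` enter the context: instance search through `K ⊆ L̄` is slow)
  have hB3 := fun (hne : L ≠ M)
      (χ : groupCohomology (Rep.trivial ℤ ((L.openNormalSubgroup : Subgroup (absoluteGaloisGroup F)) ⧸
        (traceOpenNormalSubgroup (L.openNormalSubgroup : Subgroup (absoluteGaloisGroup F)) M.openNormalSubgroup :
          Subgroup (L.openNormalSubgroup : Subgroup (absoluteGaloisGroup F)))) (ZMod m)) 1) =>
    layerPairingValue_eq_classInvAll_baseCup hLM hm φ χ x₀ (coe_baseInvariant_eq_layerVector_of_ne hLM hne φ x₀ hx₀)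
  have hsub : L = M → Subsingleton (M.1 ≃ₐ[L.1] M.1) := fun hne => GalLayer.subsingleton_algEquiv_of_eq hLM hne
  -- move the value from `K` to the layer `M` (door-c6's inflation invariance)
  haveI := hab
  haveI : NumberField K := NumberField.of_module_finite L.1 K
  letI : Algebra K M.1 := ψ.toRingHom.toAlgebra
  haveI : IsScalarTower L.1 K M.1 := IsScalarTower.of_algebraMap_eq fun r => (ψ.commutes r).symm
  rw [← IdeleCohomology.classInvAll_baseCup_bockstein_comp L.1 K M.1 m χK x₀]
  by_cases hne : L = M
  · -- degenerate layer: `Gal(M/L)` is trivial, the character vanishes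
    haveI := hsub hne
    have hχ : χK.comp (MonoidHom.toAdditive (AlgEquiv.restrictNormalHom (F := L.1) (K₁ := M.1) K)) = 0 :=
      AddMonoidHom.ext fun σ => by
        have hσ : σ = 0 := congrArg Additive.ofMul (Subsingleton.elim (Additive.toMul σ) 1)
        rw [AddMonoidHom.zero_apply, hσ, map_zero]
    rw [hχ, map_zero]
    -- the zero classes are moved across `(intModShortComplex _ m).Xᵢ = Rep.trivial _ _ _` by `change`
    change IdeleCohomology.classInvAll L.1 M.1 (IdeleCohomology.baseCup (E := M.1) x₀
      ((groupCohomology.δ (Bockstein.intModShortComplex_shortExact (M.1 ≃ₐ[L.1] M.1) m) 1 2 rfl) 0)) = 0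
    rw [map_zero]
    change IdeleCohomology.classInvAll L.1 M.1 (IdeleCohomology.baseCup (E := M.1) x₀ 0) = 0
    rw [map_zero, map_zero]
  · -- a genuine layer: the value is a layer pairing value of `φ`
    rw [← galCharacter_traceCharacter hLM (χK.comp (MonoidHom.toAdditive
        (AlgEquiv.restrictNormalHom (F := L.1) (K₁ := M.1) K))), ← hB3 hne]
    exact H M hLM _

/-- **Milne's (b) for `(U_L, Res C̄)`, injectivity side.**  If `φ : ℤ → Res_{U_L} C̄` pairs to zero with every
character of every trace layer — `inv_U (Inf (H²(id, φ_V) (β_m χ))) = 0` for all layers `E ⊇ L` and all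
`χ ∈ H¹(U_L ⧸ (U_E ∩ U_L), ℤ/m)` — then `φ = m • φ₂` for a morphism `φ₂ : ℤ → Res_{U_L} C̄`.  (The idèle class
`x̄₀ = φ(1) ∈ C_L` pairs to zero with every `β_m[χ_K]`, `K/L` finite abelian, by the previous theorem; so `x̄₀ ∈ C_Lᵐ` by
door-c6's `forall_layer_pairing_eq_zero_iff_mem_range_pow`, and `φ₂` is the invariant vector of an `m`-th root, door-c4
`homTrivEquiv`.) [cite: MilneADT2006, I Theorem 1.8 (b)]
[cite: CasselsFrohlichANT1967, Ch. VII §11.3, §5.1 Main Theorem (B), (D)][cite: Neukirch2013, Part III Thm. (7.12)] -/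
theorem exists_nsmul_eq_of_forall_layer_value_eq_zero (L : GalLayer F) {m : ℕ} (hm : 0 < m)
    (φ : triv (k := ℤ) (Γ := (L.openNormalSubgroup : Subgroup (absoluteGaloisGroup F))) ℤ ⟶
      (resD ℤ (L.openNormalSubgroup : Subgroup (absoluteGaloisGroup F))).obj (classData F).toSystem.toD)
    (H : ∀ (E : GalLayer F) (_ : L ≤ E)
      (χ : groupCohomology (Rep.trivial ℤ ((L.openNormalSubgroup : Subgroup (absoluteGaloisGroup F)) ⧸
        (traceOpenNormalSubgroup (L.openNormalSubgroup : Subgroup (absoluteGaloisGroup F)) E.openNormalSubgroup :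
          Subgroup (L.openNormalSubgroup : Subgroup (absoluteGaloisGroup F)))) (ZMod m)) 1),
      haveI : NeZero m := ⟨hm.ne'⟩
      classBarInvAt F (L.openNormalSubgroup : Subgroup (absoluteGaloisGroup F)) (LayerColimit.coe_isOpen _)
        (LayerColimit.inflG
          (traceOpenNormalSubgroup (L.openNormalSubgroup : Subgroup (absoluteGaloisGroup F)) E.openNormalSubgroup)
          ((resD ℤ (L.openNormalSubgroup : Subgroup (absoluteGaloisGroup F))).obj (classData F).toSystem.toD) 2
          (groupCohomology.map (MonoidHom.id _)
            (LayerColimit.homToLayer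
              (traceOpenNormalSubgroup (L.openNormalSubgroup : Subgroup (absoluteGaloisGroup F)) E.openNormalSubgroup :
                Subgroup (L.openNormalSubgroup : Subgroup (absoluteGaloisGroup F)))
              ((resD ℤ (L.openNormalSubgroup : Subgroup (absoluteGaloisGroup F))).obj (classData F).toSystem.toD) φ) 2
            (groupCohomology.δ (Bockstein.intModShortComplex_shortExact
              ((L.openNormalSubgroup : Subgroup (absoluteGaloisGroup F)) ⧸
                (traceOpenNormalSubgroup (L.openNormalSubgroup : Subgroup (absoluteGaloisGroup F)) E.openNormalSubgroup :
                  Subgroup (L.openNormalSubgroup : Subgroup (absoluteGaloisGroup F)))) m) 1 2 rfl χ))) = 0) :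
    ∃ φ₂ : triv (k := ℤ) (Γ := (L.openNormalSubgroup : Subgroup (absoluteGaloisGroup F))) ℤ ⟶
      (resD ℤ (L.openNormalSubgroup : Subgroup (absoluteGaloisGroup F))).obj (classData F).toSystem.toD, m • φ₂ = φ := by
  haveI : NeZero m := ⟨hm.ne'⟩
  haveI := L.numberField
  -- the class `c₀ ∈ C_L` of `φ` and an idèle `x₀` representing it
  obtain ⟨c₀, hc₀⟩ := ((classData F).mem_invariants_iff L (φ.hom.hom (1 : ℤ))).1 (hom_apply_one_mem_invariants L φ)
  obtain ⟨x₀, hx₀⟩ := QuotientGroup.mk_surjective (Additive.toMul c₀)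
  have hx₀' : ofLayer F L (Additive.ofMul (x₀ : IdeleClassGroup L.1)) = φ.hom.hom (1 : ℤ) := by
    rw [hx₀]
    exact hc₀
  -- door-c6's injectivity criterion over the base `L`
  obtain ⟨c, hc⟩ := (IdeleCohomology.forall_layer_pairing_eq_zero_iff_mem_range_pow (F := L.1) hm x₀).1
    fun K hK hab χK => classInvAll_baseCup_eq_zero_of_forall_layer_value_eq_zero L hm φ H x₀ hx₀' K hK hab χK
  -- `φ₂`: the invariant vector of the class `c` (with `c ^ m = x̄₀`)
  have hcinv : ofLayer F L (Additive.ofMul c) ∈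
      ((resD ℤ (L.openNormalSubgroup : Subgroup (absoluteGaloisGroup F))).obj (classData F).toSystem.toD).obj.ρ.invariants :=
    ((classData F).mem_invariants_iff L _).2 ⟨Additive.ofMul c, rfl⟩
  have hφ₂ : ((homTrivEquiv ((resD ℤ (L.openNormalSubgroup : Subgroup (absoluteGaloisGroup F))).obj
        (classData F).toSystem.toD) ℤ).symm (LinearMap.toSpanSingleton ℤ _ ⟨_, hcinv⟩)).hom.hom (1 : ℤ) =
      ofLayer F L (Additive.ofMul c) := by
    have h1 := homTrivEquiv_apply_coe _ ℤ ((homTrivEquiv ((resD ℤ (L.openNormalSubgroup : Subgroup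
      (absoluteGaloisGroup F))).obj (classData F).toSystem.toD) ℤ).symm (LinearMap.toSpanSingleton ℤ _ ⟨_, hcinv⟩)) 1
    rw [AddEquiv.apply_symm_apply, LinearMap.toSpanSingleton_apply_one] at h1
    exact h1.symm
  refine ⟨(homTrivEquiv _ ℤ).symm (LinearMap.toSpanSingleton ℤ _ ⟨_, hcinv⟩), (homTrivEquiv _ ℤ).injective ?_⟩
  rw [map_nsmul]
  refine LinearMap.ext_ring (Subtype.ext ?_)
  change m • (homTrivEquiv _ ℤ ((homTrivEquiv ((resD ℤ (L.openNormalSubgroup : Subgroup (absoluteGaloisGroup F))).obj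
      (classData F).toSystem.toD) ℤ).symm (LinearMap.toSpanSingleton ℤ _ ⟨_, hcinv⟩)) (1 : ℤ)).1 =
    (homTrivEquiv _ ℤ φ (1 : ℤ)).1
  rw [homTrivEquiv_apply_coe, homTrivEquiv_apply_coe, hφ₂, ← hx₀', ← hc, powMonoidHom_apply]
  change m • ofLayer F L (Additive.ofMul c) = ofLayer F L (Additive.ofMul (c ^ m))
  rw [← map_nsmul]
  exact congrArg (ofLayer F L) (ofMul_pow m c).symm

end IdeleClassBar

end Literature.NumberTheory.GaloisRepresentations

end
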